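import Summits.Ventures.DiscreteObjects.PP12.FlagTenConjunctC1
import Summits.Ventures.DiscreteObjects.PP12.FlagTenOrbitMatrix

/-!
# The `f = 10` flag-cell orbit data: equation (C3) at subtype level (kernel; Step D, conjunct 9 of `IsFlagTenOrbitMatrix` before transport)
Framing: lottery ticket; floor = certified bounds/negative ranges.

Cell pub-namedobj (venture DiscreteObjects), target (M), designs gen 14 (HOME designs-g13 FAMILY-FLAG7X §7c). Setting as in
`FlagTenOrbitDataOfPlane` (`σ³ = 1`, flag type, `f = 10`, order 12, `u₀ ∋ c` a non-fixed line; vertices = points `≠ c` of `u₀`).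
For a vertex `x`, a fixed line `m ≠ l` and a point `z ≠ c` of `m` (a T-point, its orbit `orb3 z` one of the four orbits on `m`):
`#{y fixed, y ≠ c : betaOrb m (cOrb y x) = orb3 z} + 2·[gammaOrb m x = orb3 z] + [gammaOrb m (phiVertex x) = orb3 z] = 3`
(**`vertex_tpoint_count`**), i.e. conjunct 9 `#{k : β k j (C k i) = t} + 2[γ j i = t] + [γ j (φ i) = t] = 3` before transport.
It is the plane-level identity `OrbitSideIdentities.vertex_tpoint_identity` (λ = 1 for the vertex `x` against the T-point `z`), with the
lines through `x` sorted into the c-line `u₀` (never counted: the c-line of `z` is the fixed line `m`), the T-lines `x·y` (counted iff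
`β (C) = orb3 z` on `m`), the own sides (`[gammaOrb m x = orb3 z]`, `card_sideOrbit_through`) and the foreign side of `x` (a side of the
triangle of `phiVertex x`: `[gammaOrb m (phiVertex x) = orb3 z]`). No `sorry`, no new axioms.
-/

namespace Summit.Ventures.DiscreteObjects.PP12

open Configuration Finset
open scoped Classical

namespace Collineation

variable {P L : Type*} [Membership P L] [ProjectivePlane P L] [Fintype P] [Fintype L] (σ : Collineation P L)

section Flag

variable {l : L} {c : P} (hl : σ.onLines l = l) (hc : σ.onPoints c = c) (hcl : c ∈ l)
  (hP : ∀ p : P, σ.onPoints p = p → p ∈ l) (hL : ∀ m : L, σ.onLines m = m → c ∈ m)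
  (h12 : ProjectivePlane.order P L = 12)

include hl hc hP hL in
/-- If a side of the triangle of the exterior point `x` passes through the point `z` of the fixed line `m`, then `gammaOrb m x = orb3 z`. -/
theorem gammaOrb_eq_of_sideOrbit_through (hq : σ.onPoints ^ 3 = 1) {x : P} (hxX : ∀ m' : L, σ.onLines m' = m' → x ∉ m')
    {m : L} (hm : σ.onLines m = m) {z : P} (hzm : z ∈ m) {e' : L} (he' : e' ∈ orb3 σ.onLines (σ.sideOf l x)) (hze' : z ∈ e') :
    σ.gammaOrb l c m x = orb3 σ.onPoints z := by
  have hxf : σ.onPoints x ≠ x := σ.not_fixed_of_exterior_flag hl hP hxX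
  obtain ⟨hxa, hσxa⟩ := σ.sideOf_spec l hxf
  obtain ⟨-, ha0⟩ := σ.side_no_fixed_point hxf hxX hxa hσxa
  have hca : c ∉ σ.sideOf l x := fun h => ha0 c hc h
  have he'0 := σ.orb3_side_noFixed ha0 he'
  have he'm : e' ≠ m := fun e => he'0 c hc (e ▸ hL m hm)
  change orb3 σ.onPoints (meetPt c (σ.sideOf l x) m) = orb3 σ.onPoints z
  rw [← σ.betaOrb_eq hc hL hq hm hca (self_mem_orb3 _ _), σ.betaOrb_eq hc hL hq hm hca he', ← meetPt_eq c he'm hze' hzm]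

include hl hc hP hL in
/-- **The sides of the triangle of `x` through a T-point `z ∈ m`:** exactly `[gammaOrb m x = orb3 z]` of them. -/
theorem card_sideOrbit_through (hq : σ.onPoints ^ 3 = 1) {x : P} (hxX : ∀ m' : L, σ.onLines m' = m' → x ∉ m')
    {m : L} (hm : σ.onLines m = m) {z : P} (hzm : z ∈ m) :
    ((orb3 σ.onLines (σ.sideOf l x)).filter fun e' => z ∈ e').card = flagInd (σ.gammaOrb l c m x = orb3 σ.onPoints z) := by
  have hxf : σ.onPoints x ≠ x := σ.not_fixed_of_exterior_flag hl hP hxX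
  obtain ⟨hxa, hσxa⟩ := σ.sideOf_spec l hxf
  obtain ⟨-, ha0⟩ := σ.side_no_fixed_point hxf hxX hxa hσxa
  have ham : σ.sideOf l x ≠ m := fun e => ha0 c hc (e ▸ hL m hm)
  have hwf := (σ.gammaOrb_mem hl hc hP hL hxX hm).2.2.2
  unfold flagInd
  by_cases hγ : σ.gammaOrb l c m x = orb3 σ.onPoints z
  · rw [if_pos hγ]
    have hzw : z ∈ orb3 σ.onPoints (meetPt c (σ.sideOf l x) m) := by
      change orb3 σ.onPoints (meetPt c (σ.sideOf l x) m) = orb3 σ.onPoints z at hγ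
      rw [hγ]; exact self_mem_orb3 _ _
    obtain ⟨⟨e', he', hze'⟩, hle⟩ := σ.side_orbit_line_through (c := c) hq hm ham hwf hzw
    have hpos : 0 < ((orb3 σ.onLines (σ.sideOf l x)).filter fun e'' => z ∈ e'').card :=
      card_pos.2 ⟨e', mem_filter.2 ⟨he', hze'⟩⟩
    omega
  · rw [if_neg hγ, card_eq_zero, filter_eq_empty_iff]
    intro e' he' hze'
    exact hγ (σ.gammaOrb_eq_of_sideOrbit_through hl hc hP hL hq hxX hm hzm he' hze')

include hl hc hcl hP hL h12 in
/-- **(C3) at subtype level** (`f = 10`): see the module docstring. -/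
theorem vertex_tpoint_count (hq : σ.onPoints ^ 3 = 1) (hf : fixedCard σ.onPoints = 10) {u₀ : L} (hcu₀ : c ∈ u₀) (hu₀ : σ.onLines u₀ ≠ u₀)
    {x : P} (hxu : x ∈ u₀) (hxc : x ≠ c) {m : L} (hm : σ.onLines m = m) (hml : m ≠ l) {z : P} (hzm : z ∈ m) (hzc : z ≠ c) :
    (univ.filter fun y : P => σ.onPoints y = y ∧ y ≠ c ∧ σ.betaOrb c m (σ.cOrb l y x) = orb3 σ.onPoints z).card
      + 2 * flagInd (σ.gammaOrb l c m x = orb3 σ.onPoints z)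
      + flagInd (σ.gammaOrb l c m (σ.phiVertex l c u₀ x) = orb3 σ.onPoints z) = 3 := by
  have hqL : σ.onLines ^ 3 = 1 := σ.onLines_pow_eq_one hq
  have hxX := σ.exterior_of_mem_cline hL hcu₀ hu₀ hxu hxc
  have hxf : σ.onPoints x ≠ x := σ.not_fixed_of_exterior_flag hl hP hxX
  obtain ⟨hxa, hσxa⟩ := σ.sideOf_spec l hxf
  obtain ⟨-, ha0⟩ := σ.side_no_fixed_point hxf hxX hxa hσxa
  have h3 := apply_three σ.onPoints hq
  have h3L := apply_three σ.onLines hqL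
  -- z is a T-point: not fixed, not on l
  have hzf : σ.onPoints z ≠ z := fun e => hzc ((Nondegenerate.eq_or_eq hzm (hL m hm) (hP z e) hcl).resolve_right hml)
  -- the vertex x with its side orbit e = σ²(x·σx) ∋ x, σe ∋ x
  set e : L := σ.onLines (σ.onLines (σ.sideOf l x)) with he_def
  have hxe : x ∈ e := by have := σ.mem_map (σ.mem_map hσxa); rw [h3] at this; exact this
  have hxσe : x ∈ σ.onLines e := by rw [he_def, h3L]; exact hxa
  have heo : orb3 σ.onLines e = orb3 σ.onLines (σ.sideOf l x) :=
    orb3_eq_of_mem σ.onLines hqL ((mem_orb3 _ _ _).2 (Or.inr (Or.inr rfl)))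
  have hne_e : σ.onLines e ≠ e := by
    intro h'; exact (σ.orb3_side_noFixed ha0 ((mem_orb3 _ _ _).2 (Or.inr (Or.inr rfl)))) c hc (hL e h')
  have hx0 : ∀ g : L, x ∈ g → σ.onLines g ≠ g := fun g hxg hg => hxX g hg hxg
  -- (C3) at plane level
  have hid := σ.vertex_tpoint_identity hq hne_e hxf hxe hxσe hx0 hzf hm hzm
  rw [heo, σ.card_sideOrbit_through hl hc hP hL hq hxX hm hzm] at hid
  -- the foreign side of x and the triangle x' = phiVertex x owning it
  obtain ⟨hx'u, hx'c, ⟨Q, hQx', hQF, hσQF⟩, hne⟩ := σ.phiVertex_spec hl hc hcl hP hL h12 hq hf hcu₀ hu₀ hxX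
  obtain ⟨hxF, hF0, hF1, hF2⟩ := σ.foreignSide_spec hl hP h12 hq hf hxX
  have hx'X := σ.exterior_of_mem_cline hL hcu₀ hu₀ hx'u hx'c
  have hx'f : σ.onPoints (σ.phiVertex l c u₀ x) ≠ σ.phiVertex l c u₀ x := σ.not_fixed_of_exterior_flag hl hP hx'X
  have hQX := σ.exterior_of_mem_orb3 hx'X hQx'
  have hQf : σ.onPoints Q ≠ Q := σ.not_fixed_of_exterior_flag hl hP hQX
  have hFo : σ.foreignSide l x ∈ orb3 σ.onLines (σ.sideOf l (σ.phiVertex l c u₀ x)) :=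
    σ.mem_orb3_sideOf_of_side hq hx'f hQx' hQf hQF hσQF
  have hFoe : orb3 σ.onLines (σ.foreignSide l x) = orb3 σ.onLines (σ.sideOf l (σ.phiVertex l c u₀ x)) :=
    orb3_eq_of_mem σ.onLines hqL hFo
  have hFno : σ.foreignSide l x ∉ orb3 σ.onLines (σ.sideOf l x) := by
    intro h'
    obtain ⟨R, hRx, hRF, hσRF⟩ := σ.side_of_mem_orb3_sideOf hq hxf h'
    have hRX := σ.exterior_of_mem_orb3 hxX hRx
    have hQR : Q = R := σ.side_unique hRX hRF hσRF hQF hσQF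
    apply hne
    rw [← orb3_eq_of_mem σ.onPoints hq hQx', hQR, orb3_eq_of_mem σ.onPoints hq hRx]
  -- the second term: T-lines x·y with β(C) = orb3 z, and the foreign side iff a side of the triangle of x' passes through z
  set N : Finset P := univ.filter fun y : P => σ.onPoints y = y ∧ y ≠ c ∧
      σ.betaOrb c m (σ.cOrb l y x) = orb3 σ.onPoints z with hN
  set R : Finset L := univ.filter fun g : L => x ∈ g ∧ g ∉ orb3 σ.onLines (σ.sideOf l x) ∧
      ∃ g' ∈ orb3 σ.onLines g, z ∈ g' with hR_def
  have hyσ : ∀ {y : P}, σ.onPoints y = y → ∀ g : L, y ∈ g → y ∈ σ.onLines g := fun hy g hg => by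
    have := σ.mem_map hg; rwa [hy] at this
  have hRdesc : R = (N.image fun y => lineThrough l x y) ∪
      (if σ.gammaOrb l c m (σ.phiVertex l c u₀ x) = orb3 σ.onPoints z then {σ.foreignSide l x} else ∅) := by
    ext g
    rw [hR_def, mem_filter, mem_union, mem_image]
    constructor
    · rintro ⟨-, hxg, hg1, g', hg', hzg'⟩
      by_cases hcg : c ∈ g
      · -- g = u₀: the c-lines pass through c, and the c-line of z is the fixed line m
        exfalso
        have hgu : g = u₀ := (Nondegenerate.eq_or_eq hxg hcg hxu hcu₀).resolve_left hxc
        rw [hgu] at hg'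
        have hcσ : ∀ v : L, c ∈ v → c ∈ σ.onLines v := fun v hv => by have := σ.mem_map hv; rwa [hc] at this
        have hnfσ : ∀ v : L, σ.onLines v ≠ v → σ.onLines (σ.onLines v) ≠ σ.onLines v := fun v hv e0 => hv (σ.onLines.injective e0)
        have hcg' : c ∈ g' ∧ σ.onLines g' ≠ g' := by
          rw [mem_orb3] at hg'
          rcases hg' with rfl | rfl | rfl
          · exact ⟨hcu₀, hu₀⟩
          · exact ⟨hcσ _ hcu₀, hnfσ _ hu₀⟩
          · exact ⟨hcσ _ (hcσ _ hcu₀), hnfσ _ (hnfσ _ hu₀)⟩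
        have hg'm : g' = m := (Nondegenerate.eq_or_eq hzg' hcg'.1 hzm (hL m hm)).resolve_left hzc
        exact hcg'.2 (by rw [hg'm]; exact hm)
      · by_cases hfix : ∃ y : P, σ.onPoints y = y ∧ y ∈ g
        · -- a T-line x·y
          left
          obtain ⟨y, hy, hyg⟩ := hfix
          have hyc : y ≠ c := fun e0 => hcg (e0 ▸ hyg)
          have hxy : x ≠ y := fun e0 => hxf (by rw [e0, hy])
          obtain ⟨hxk, hyk⟩ := lineThrough_spec l hxy
          have hgk : g = lineThrough l x y := (Nondegenerate.eq_or_eq hxg hyg hxk hyk).resolve_left hxy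
          have hyg' : y ∈ g' := by
            rw [mem_orb3] at hg'
            rcases hg' with rfl | rfl | rfl
            · exact hyg
            · exact hyσ hy _ hyg
            · exact hyσ hy _ (hyσ hy _ hyg)
          have hym : y ∉ m := fun hym => hml ((Nondegenerate.eq_or_eq hym (hL m hm) (hP y hy) hcl).resolve_left hyc)
          have hg'm : g' ≠ m := fun e0 => hym (e0 ▸ hyg')
          refine ⟨y, ?_, hgk.symm⟩
          rw [hN, mem_filter]
          refine ⟨mem_univ _, hy, hyc, ?_⟩
          change σ.betaOrb c m (orb3 σ.onLines (lineThrough l x y)) = orb3 σ.onPoints z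
          rw [← hgk, σ.betaOrb_eq hc hL hq hm hcg hg', ← meetPt_eq c hg'm hzg' hzm]
        · -- an exterior line through x that is not an own side: the foreign side
          right
          push Not at hfix
          have hg0 : ∀ p : P, σ.onPoints p = p → p ∉ g := fun p hp => hfix p hp
          have hσxg : σ.onPoints x ∉ g := fun h' =>
            hg1 (σ.mem_orb3_sideOf_of_side hq hxf (self_mem_orb3 _ _) hxf hxg h')
          have hσ2xg : σ.onPoints (σ.onPoints x) ∉ g := by
            intro h'
            have hσ2f : σ.onPoints (σ.onPoints (σ.onPoints x)) ≠ σ.onPoints (σ.onPoints x) := by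
              rw [h3]; exact fun e0 => (σ.sq_ne_of_cube hq hxf).1 e0.symm
            exact hg1 (σ.mem_orb3_sideOf_of_side hq hxf ((mem_orb3 _ _ _).2 (Or.inr (Or.inr rfl))) hσ2f h' (by rw [h3]; exact hxg))
          obtain ⟨F', -, huniq⟩ := σ.existsUnique_foreign_side hl hP h12 hq hf hxX
          have hgF : g = σ.foreignSide l x :=
            (huniq g ⟨hxg, hg0, hσxg, hσ2xg⟩).trans (huniq _ ⟨hxF, hF0, hF1, hF2⟩).symm
          rw [hgF, hFoe] at hg'
          have hγ' := σ.gammaOrb_eq_of_sideOrbit_through hl hc hP hL hq hx'X hm hzm hg' hzg'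
          rw [if_pos hγ', mem_singleton]
          exact hgF
    · rintro (⟨y, hyN, hg0⟩ | hg0)
      · rw [hN, mem_filter] at hyN
        obtain ⟨-, hy, hyc, hβ⟩ := hyN
        have hxy : x ≠ y := fun e0 => hxf (by rw [e0, hy])
        obtain ⟨hxk, hyk⟩ := lineThrough_spec l hxy
        have hkl : lineThrough l x y ≠ l := fun e0 => hxX l hl (e0 ▸ hxk)
        have hcg : c ∉ lineThrough l x y := σ.c_not_mem_tline hcl hP hy hyc hyk hkl
        rw [← hg0]
        refine ⟨mem_univ _, hxk, fun h' => σ.orb3_side_noFixed ha0 h' y hy hyk, ?_⟩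
        -- the point of x·y on m and the line of the orbit through z
        obtain ⟨w, hwk, hwm, hwf, -, huniq⟩ := σ.tline_inter_fixedLine hcl hP hL hy hyc hyk hkl hm hml
        have hkm : lineThrough l x y ≠ m := fun e0 => hcg (e0 ▸ hL m hm)
        have hw : meetPt c (lineThrough l x y) m = w := huniq _ (meetPt_spec c hkm).1 (meetPt_spec c hkm).2
        change σ.betaOrb c m (orb3 σ.onLines (lineThrough l x y)) = orb3 σ.onPoints z at hβ
        rw [σ.betaOrb_eq hc hL hq hm hcg (self_mem_orb3 _ _)] at hβ
        have hzw : z ∈ orb3 σ.onPoints (meetPt c (lineThrough l x y) m) := by rw [hβ]; exact self_mem_orb3 _ _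
        exact (σ.side_orbit_line_through (c := c) hq hm hkm (by rw [hw]; exact hwf) hzw).1
      · by_cases hγ' : σ.gammaOrb l c m (σ.phiVertex l c u₀ x) = orb3 σ.onPoints z
        · rw [if_pos hγ', mem_singleton] at hg0
          rw [hg0]
          refine ⟨mem_univ _, hxF, hFno, ?_⟩
          -- a side of the triangle of x' through z: a line of orb3 F
          obtain ⟨hx'a', hσx'a'⟩ := σ.sideOf_spec l hx'f
          obtain ⟨-, ha0'⟩ := σ.side_no_fixed_point hx'f hx'X hx'a' hσx'a'
          have ha'm : σ.sideOf l (σ.phiVertex l c u₀ x) ≠ m := fun e0 => ha0' c hc (e0 ▸ hL m hm)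
          have hw'f := (σ.gammaOrb_mem hl hc hP hL hx'X hm).2.2.2
          have hzw' : z ∈ orb3 σ.onPoints (meetPt c (σ.sideOf l (σ.phiVertex l c u₀ x)) m) := by
            change orb3 σ.onPoints (meetPt c (σ.sideOf l (σ.phiVertex l c u₀ x)) m) = orb3 σ.onPoints z at hγ'
            rw [hγ']; exact self_mem_orb3 _ _
          rw [hFoe]
          exact (σ.side_orbit_line_through (c := c) hq hm ha'm hw'f hzw').1
        · rw [if_neg hγ'] at hg0
          exact absurd hg0 (Finset.notMem_empty _)
  -- counting: x·y ≠ x·y' for fixed y ≠ y', and the foreign side is not a T-line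
  have hinj : Set.InjOn (fun y => lineThrough l x y) ↑N := by
    intro y₁ hy₁ y₂ hy₂ hk
    rw [mem_coe, hN, mem_filter] at hy₁ hy₂
    obtain ⟨-, hy₁', -, -⟩ := hy₁
    obtain ⟨-, hy₂', -, -⟩ := hy₂
    have hxy₁ : x ≠ y₁ := fun e0 => hxf (by rw [e0, hy₁'])
    have hxy₂ : x ≠ y₂ := fun e0 => hxf (by rw [e0, hy₂'])
    obtain ⟨hxk₁, hy₁k⟩ := lineThrough_spec l hxy₁
    obtain ⟨-, hy₂k⟩ := lineThrough_spec l hxy₂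
    have hk' : lineThrough l x y₁ = lineThrough l x y₂ := hk
    rw [← hk'] at hy₂k
    by_contra hne'
    have hkl : lineThrough l x y₁ = l := (Nondegenerate.eq_or_eq hy₁k hy₂k (hP y₁ hy₁') (hP y₂ hy₂')).resolve_left hne'
    exact hxX l hl (hkl ▸ hxk₁)
  have hdisj : Disjoint (N.image fun y => lineThrough l x y)
      (if σ.gammaOrb l c m (σ.phiVertex l c u₀ x) = orb3 σ.onPoints z then {σ.foreignSide l x} else ∅) := by
    by_cases hγ' : σ.gammaOrb l c m (σ.phiVertex l c u₀ x) = orb3 σ.onPoints z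
    · rw [if_pos hγ', disjoint_singleton_right, mem_image]
      rintro ⟨y, hyN, hk⟩
      rw [hN, mem_filter] at hyN
      obtain ⟨-, hy, -, -⟩ := hyN
      have hxy : x ≠ y := fun e0 => hxf (by rw [e0, hy])
      have hyk := (lineThrough_spec l hxy).2
      rw [hk] at hyk
      exact hF0 y hy hyk
    · rw [if_neg hγ']; exact disjoint_empty_right _
  have hRcard : R.card = N.card + flagInd (σ.gammaOrb l c m (σ.phiVertex l c u₀ x) = orb3 σ.onPoints z) := by
    rw [hRdesc, card_union_of_disjoint hdisj, card_image_of_injOn hinj]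
    congr 1
    unfold flagInd
    by_cases hγ' : σ.gammaOrb l c m (σ.phiVertex l c u₀ x) = orb3 σ.onPoints z
    · rw [if_pos hγ', card_singleton, if_pos hγ']
    · rw [if_neg hγ', card_empty, if_neg hγ']
  rw [hRcard] at hid
  omega

end Flag

end Collineation

end Summit.Ventures.DiscreteObjects.PP12
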